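import Literature.NumberTheory.PAdicHodge.SenDecompletionRankOne
import HarnessLib

/-!
# Tate's normalised trace is linear over the `γ`-invariants (Berger–Colmez (TS2)(2))

Notation as in `TateInvariantsBase`: `K₀ = PadicBase F p hp ≅ ℚ_p`, `K n = K₀(ζ_{pⁿ})`, `K_∞ = ⋃ K n`,
`S = K_∞ ⊆ ℂ_F`, `X = \widehat{K_∞}` its closure, `γ = γ_n = TateTrace.gen n`, `R_n` Tate's normalised
trace (`traceToLevel n M` on `K M`, `Rfun n` on `S`, `Rhat n` on `X`).

The tree records that `R_n` is additive, `K₀`-linear (`Rhat_mulX`), idempotent, commutes with `G₀` and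
fixes `K n`; this file adds the remaining clause of the Tate–Sen axiom (TS2)(2): **`R_n` is linear over
its image**, i.e. over the `γ_n`-invariants `X^{γ_n = 1} = K n` (`TateTrace.mem_image_K_of_gen_smul_eq`):

* `TateTrace.avg_mul_of_smul_eq` — the orbit average `avg δ N` is linear over `δ`-fixed elements;
* `TateTrace.traceToLevel_mul_of_gen_smul_eq` — `R_n (w x) = w R_n x` on `K M` for `γ_n w = w`;
* `TateTrace.Rfun_coe_mul` — the same on `S` for `w ∈ K n`;
* ★ `TateTrace.Rhat_mul_of_gen_smul_eq` — **`R_n (w x) = w · R_n x` on `X` for every `w ∈ X` with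
  `γ_n w = w`** (by density of `S` in `X` and continuity of `R_n`).

This is the input for the uniqueness half of Sen's method (Berger–Colmez Lemme 3.2.5: `R_{H,n}` is
`Λ_{H,n}`-linear and commutes with `γ`). Everything is proved; no named facts.

References: L. Berger, P. Colmez, Astérisque 319 (2008), Déf. 3.1.3 (TS2)(2) [BergerColmez2008];
J. Tate, *p-divisible groups* (1967), §3.1 [Tate1967].
-/

noncomputable section

open ValuativeRel Field UniformSpace Filter Topology Finset

open scoped IntermediateField

namespace Literature.NumberTheory.PAdicHodge

open Literature.NumberTheory.GaloisRepresentations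
open Literature.NumberTheory.GaloisRepresentations.IsNonarchimedeanLocalField
open CyclotomicTower

variable {F : Type} [Field F] [ValuativeRel F] [TopologicalSpace F] [IsNonarchimedeanLocalField F]
  [CharZero F] {p : ℕ} [Fact p.Prime] (hp : valuation F p < 1)

namespace TateTrace

/-- **The orbit average `avg δ N x = N⁻¹ Σ_{k<N} δᵏ x` is linear over `δ`-fixed elements**:
`avg δ N (w x) = w · avg δ N x` when `δ w = w`. [cite: Tate1967, §3.1]
[cite: BergerColmez2008, Déf. 3.1.3 (TS2)(2)] -/
theorem avg_mul_of_smul_eq (δ : BaseGaloisGroup hp) (N : ℕ) {w : NormedAlgClosure F} (hw : δ • w = w)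
    (x : NormedAlgClosure F) : avg hp δ N (w * x) = w * avg hp δ N x := by
  have hk : ∀ k : ℕ, δ ^ k • w = w := by
    intro k
    induction k with
    | zero => rw [pow_zero, one_smul]
    | succ k ih => rw [pow_succ, mul_smul, hw, ih]
  rw [avg_def, avg_def, mul_smul_comm]
  congr 1
  simp_rw [smul_mul', hk]
  exact (Finset.mul_sum (range N) (fun k => δ ^ k • x) w).symm

/-- `γ_n` fixes `K n` pointwise. [folklore] -/
private theorem gen_smul_eq_self_of_mem_K {n : ℕ} (hn : 1 ≤ n) {x : NormedAlgClosure F}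
    (hx : x ∈ K hp n) : gen hp n • x = x := by
  have h := gen_smul_zeta_self hp hn
  have h1 : gen hp n • zeta F p n = (1 : BaseGaloisGroup hp) • zeta F p n := by rw [h, one_smul]
  have h2 := smul_eq_smul_of_smul_zeta_eq hp h1 hx
  rwa [one_smul] at h2

/-- **`R_n` on `K M` is linear over `γ_n`-fixed elements**: `R_n (w x) = w R_n x` if `γ_n w = w`.
[cite: BergerColmez2008, Déf. 3.1.3 (TS2)(2)] [cite: Tate1967, §3.1] -/
theorem traceToLevel_mul_of_gen_smul_eq (n M : ℕ) {w : NormedAlgClosure F} (hw : gen hp n • w = w)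
    (x : NormedAlgClosure F) : traceToLevel hp n M (w * x) = w * traceToLevel hp n M x := by
  rw [traceToLevel_def, traceToLevel_def, avg_mul_of_smul_eq hp _ _ hw]

/-- **`R_n` on `S = K_∞` is `K n`-linear**: `R_n (w s) = w R_n s` for `w ∈ K n`.
[cite: BergerColmez2008, Déf. 3.1.3 (TS2)(2)] [cite: Tate1967, §3.1] -/
theorem Rfun_coe_mul {n : ℕ} (hn : 1 ≤ n) {w : NormedAlgClosure F} (hw : w ∈ K hp n) (s : S hp)
    (h : (w : CompletedAlgClosure F) * (s : CompletedAlgClosure F) ∈ S hp) :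
    Rfun hp n ⟨(w : CompletedAlgClosure F) * s, h⟩ = (w : CompletedAlgClosure F) * Rfun hp n s := by
  obtain ⟨hl, hmem⟩ := lvl_spec hp n s
  have hy : ((w * pre hp s : NormedAlgClosure F) : CompletedAlgClosure F) =
      (w : CompletedAlgClosure F) * (s : CompletedAlgClosure F) := by
    rw [Completion.coe_mul, coe_pre]
  have hwM : w ∈ K hp (lvl hp n s) := K_mono hp (by omega : n ≤ lvl hp n s) hw
  rw [Rfun_eq hp hn hy hl (mul_mem hwM hmem),
    traceToLevel_mul_of_gen_smul_eq hp n _ (gen_smul_eq_self_of_mem_K hp hn hw), Completion.coe_mul, Rfun]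

/-- ★ **Tate's normalised trace `R_n : X → X` is linear over the `γ_n`-invariants of `X`** (which are
`K n`, `mem_image_K_of_gen_smul_eq`): for `w ∈ X` with `γ_n w = w` and `x ∈ X`,
`R_n (w · x) = w · R_n x`. Proof: `w = ↑w₀`, `w₀ ∈ K n`; the identity holds on the dense subset `S`
(`Rfun_coe_mul`) and both sides are continuous in `x`. This is clause (TS2)(2) of the Tate–Sen axioms
for `Λ̃ = ℂ_F`, `H = H_{K₀}`. [cite: BergerColmez2008, Déf. 3.1.3 (TS2)(2)] [cite: Tate1967, §3.1] -/
theorem Rhat_mul_of_gen_smul_eq {n : ℕ} (hn : 2 ≤ n) {w : CompletedAlgClosure F} (hwX : w ∈ X hp)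
    (hγw : gen hp n • w = w) (x : X hp) :
    Rhat hp n ⟨w * (x : CompletedAlgClosure F), mul_mem_X hp hwX x.2⟩ = w * Rhat hp n x := by
  obtain ⟨w₀, hw₀, hw₀w⟩ := mem_image_K_of_gen_smul_eq hp hn hwX hγw
  subst hw₀w
  have hcont : Continuous fun x : X hp =>
      (⟨(w₀ : CompletedAlgClosure F) * (x : CompletedAlgClosure F), mul_mem_X hp hwX x.2⟩ : X hp) :=
    ((continuous_const_mul _).comp continuous_subtype_val).subtype_mk _
  refine isClosed_property (denseRange_incl hp)
    (p := fun x : X hp => Rhat hp n ⟨(w₀ : CompletedAlgClosure F) * (x : CompletedAlgClosure F),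
      mul_mem_X hp hwX x.2⟩ = (w₀ : CompletedAlgClosure F) * Rhat hp n x)
    (isClosed_eq ((continuous_Rhat hp hn).comp hcont)
      ((continuous_const_mul _).comp (continuous_Rhat hp hn))) (fun s => ?_) x
  obtain ⟨y, hy, hys⟩ := (mem_S_iff hp).mp s.2
  have hmem : (w₀ : CompletedAlgClosure F) * (s : CompletedAlgClosure F) ∈ S hp := by
    rw [← hys, ← Completion.coe_mul]
    exact coe_mem_S hp (mul_mem (K_le_Kinf hp n hw₀) hy)
  have h1 : (⟨(w₀ : CompletedAlgClosure F) * ((incl hp s : X hp) : CompletedAlgClosure F),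
      mul_mem_X hp hwX (incl hp s).2⟩ : X hp) = incl hp ⟨(w₀ : CompletedAlgClosure F) * s, hmem⟩ := rfl
  rw [h1, Rhat_incl hp hn, Rhat_incl hp hn, Rfun_coe_mul hp (by omega) hw₀]

/-- **Two-sided form**: `R_n (w · x · w') = w · R_n(x) · w'` for `γ_n`-fixed `w, w' ∈ X` — the shape in
which (TS2)(2) enters Sen's uniqueness lemma (Berger–Colmez Lemme 3.2.5, `R_{H,n}(V₁ B V₂) = V₁ R_{H,n}(B) V₂`
entrywise). [cite: BergerColmez2008, Déf. 3.1.3 (TS2)(2) and Lemme 3.2.5] -/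
theorem Rhat_mul_mul_of_gen_smul_eq {n : ℕ} (hn : 2 ≤ n) {w w' : CompletedAlgClosure F}
    (hwX : w ∈ X hp) (hγw : gen hp n • w = w) (hw'X : w' ∈ X hp) (hγw' : gen hp n • w' = w')
    (x : X hp) :
    Rhat hp n ⟨w * (x : CompletedAlgClosure F) * w', mul_mem_X hp (mul_mem_X hp hwX x.2) hw'X⟩ =
      w * Rhat hp n x * w' := by
  have h1 : (⟨w * (x : CompletedAlgClosure F) * w', mul_mem_X hp (mul_mem_X hp hwX x.2) hw'X⟩ : X hp) =
      ⟨w * ((⟨w' * (x : CompletedAlgClosure F), mul_mem_X hp hw'X x.2⟩ : X hp) : CompletedAlgClosure F),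
        mul_mem_X hp hwX (mul_mem_X hp hw'X x.2)⟩ := by
    apply Subtype.ext
    simp only
    ring
  rw [h1, Rhat_mul_of_gen_smul_eq hp hn hwX hγw, Rhat_mul_of_gen_smul_eq hp hn hw'X hγw']
  ring

end TateTrace

end Literature.NumberTheory.PAdicHodge
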